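import Mathlib
import Summits.ResolutionOfSingularities.ResolutionOfSingularities.Theorems.WeightedInvariantLocalWeightedDropWildMonicFlagSettingDict
import Summits.ResolutionOfSingularities.ResolutionOfSingularities.Theorems.WeightedInvariantLocalWeightedDropWildMonicFlagNnDefs

/-!
# S3ρ flag line, (D2) `DropAxisTangentFirst` — part B: THE PERTURBED WEIGHT `(K, K·n + 1)` READS `(m, d)` LEXICOGRAPHICALLY
# (Perlega's vector weight `ψ = ((1,0),(n,1))` of Prop. 7.4.7 as one scalar weight for large `K`)

Crux item stmt-ResolutionOfSingularities-8899 `LocalWeightedDrop` (route `ResolutionOfSingularities/WeightedInvariant`), engine of the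
door `HypersurfaceCentreConstruction` stmt-ResolutionOfSingularities-19897.  [OURS · L1 W4.3, chain w43, res-D-pv-056 AS res-L1-w43-stub-5
on target (D2) `DropAxisTangentFirst` of res-type-083's `…WildMonicFlagDropAxisSplit`.  MAP: S. Perlega, arXiv:2011.14443 §7.4 Prop. 7.4.7
(`cleaning_tangential_flags`: «Let `f ∈ I₃` be an element that is `ψ_{F,x}`-clean with respect to `J_{2,x}`. Then (1) the flag `F` is
valid; (2) for all valid flags `G` of the form `G₂ = V(z+g)`, `G₁ = V(z+g, y)` the inequality `inv(G) ≤ inv(F)` holds»), proved there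
by Prop. 5.1.3 for the VECTOR weighted order `ψ(x) = (1,0)`, `ψ(y₁) = (n,1)`.  Here the vector weight is replaced by the SCALAR weight
`w_K = (K, K·n + 1)` with `K` larger than every relevant height, so that res-D-pv-005 AS stub-7's scalar Prop. 5.1.3
(`wMin_shift_le_of_isWClean`, …WildMonicShiftOrderCases) applies verbatim.  Every object is OURS; nothing here is a statement of
H. Hironaka's manuscript [claim: Hironaka2017, status: under-review].]

With `N = newtonSet A`, `m = wOrdN n N` (the `d!`-scaled `(1,n)`-order), `ih = initHeight n N` (the least height on the `(1,n)`-initial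
line — `d_{F,x}` before the conventions), the `w_K`-weight of a point is `K·(P₀ + n·P₁) + P₁`, so:
* `kmul_wOrdN_le_wMin` — `K·m ≤ wMin w_K A` always; `wMin_kWeight_le` — `wMin w_K A ≤ K·m + ih`; `wMin_kWeight_eq` — equality once
  `K ≥ ih`;
* `wOrdN_le_of_wMin_kWeight_le`, `initHeight_le_of_wMin_kWeight_le` — a `w_K`-comparison of two tuples is the LEXICOGRAPHIC comparison of
  `(m, ih)` (for `K` above the heights);
* `dFlagN_le_dFlagN`, `dFlagN_eq_zero_of_wOrdN_lt`, `mFlagN_mono` — Hauser–Perlega's conventions for `(m_F, d_F)` are monotone in `(m, ih)`;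
* `dFlagN_le_of_wMin_kWeight_le` — THE USE: if `wMin w_K C ≤ wMin w_K S` (e.g. `S` is `w_K`-clean and `C` a re-centring of it), `m_F(S) ≤
  m_F(C)` (e.g. `C` belongs to an `m`-maximal flag) and `K > m(S)`, then `d_F(C) ≤ d_F(S)`.
-/

set_option linter.dupNamespace false -- mandated namespace of this single-conjunct summit

noncomputable section

namespace Summit.ResolutionOfSingularities.ResolutionOfSingularities.Theorems

namespace WildMonic

open MvPowerSeries MonicDescent

variable {k : Type} [Field k] {d : ℕ}

/-! ## The perturbed weight on points -/

/-- The `(K, K·n+1)`-weight of a point is `K·(P₀ + n·P₁) + P₁`. -/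
theorem weight_kWeight (K n : ℕ) (P : Fin 2 →₀ ℕ) : Finsupp.weight ![K, K * n + 1] P = K * (P 0 + n * P 1) + P 1 := by
  rw [weight_fin_two]
  simp only [Matrix.cons_val_zero, Matrix.cons_val_one]
  ring

/-- The source weight of `(K, K·n+1)` under the monomial point step is `(K, K·(n+1)+1)` — the perturbed weight of tangency `n + 1`. -/
theorem srcWeight_kWeight (K n : ℕ) : srcWeight ![K, K * n + 1] = ![K, K * (n + 1) + 1] := by
  funext i
  fin_cases i
  · simp [srcWeight]
  · simp [srcWeight]; ring

/-- `wMin w A ≤ w(P)` for every point `P` of the scaled Newton set. -/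
theorem wMin_le_weight_of_mem_newtonSet (w : Fin 2 → ℕ) (A : Fin d → MvPowerSeries (Fin 2) k) {P : Fin 2 →₀ ℕ}
    (hP : P ∈ newtonSet A) : wMin w A ≤ (Finsupp.weight w P : ℕ∞) := by
  obtain ⟨j, e, he, rfl⟩ := (mem_newtonSet_iff A P).1 hP
  refine le_trans (iInf_le _ j) ?_
  unfold slotWOrd
  rw [map_nsmul, smul_eq_mul, Nat.cast_mul]
  exact mul_le_mul_right (weightedOrder_le w he) _

/-- The `d!`-scaled `(1,n)`-order of the Newton set is the `toNat` of stub-7's `wMin` for the weight `(1, n)`. -/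
theorem wOrdN_newtonSet_eq (n : ℕ) (A : Fin d → MvPowerSeries (Fin 2) k) : wOrdN n (newtonSet A) = (wMin ![1, n] A).toNat := by
  rw [toNat_wMin_eq_sInf, wOrdN_def]
  congr 1
  ext m
  simp only [Set.mem_image, weight_fin_two, Matrix.cons_val_zero, Matrix.cons_val_one, one_mul]

/-- `n · ih ≤ m`: the initial height lies on the initial line. -/
theorem mul_initHeight_le_wOrdN (n : ℕ) {N : Set (Fin 2 →₀ ℕ)} (hN : N.Nonempty) : n * initHeight n N ≤ wOrdN n N := by
  obtain ⟨P, _, hPw, hPh⟩ := exists_eq_initHeight n hN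
  rw [← hPh, ← hPw]
  exact Nat.le_add_left _ _

/-- `ih ≤ m` for `n ≥ 1`. -/
theorem initHeight_le_wOrdN {n : ℕ} (hn : 0 < n) {N : Set (Fin 2 →₀ ℕ)} (hN : N.Nonempty) : initHeight n N ≤ wOrdN n N :=
  le_trans (Nat.le_mul_of_pos_left _ hn) (mul_initHeight_le_wOrdN n hN)

/-! ## `wMin` for the perturbed weight -/

/-- LOWER BOUND: `K·m ≤ wMin w_K A`. -/
theorem kmul_wOrdN_le_wMin (K n : ℕ) (A : Fin d → MvPowerSeries (Fin 2) k) :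
    ((K * wOrdN n (newtonSet A) : ℕ) : ℕ∞) ≤ wMin ![K, K * n + 1] A := by
  rw [le_wMin_iff_newtonSet]
  intro P hP
  rw [weight_kWeight, Nat.cast_le]
  exact le_trans (Nat.mul_le_mul_left K (wOrdN_le n hP)) (Nat.le_add_right _ _)

/-- UPPER BOUND: `wMin w_K A ≤ K·m + ih` (the initial point of least height). -/
theorem wMin_kWeight_le (K n : ℕ) (A : Fin d → MvPowerSeries (Fin 2) k) (hN : (newtonSet A).Nonempty) :
    wMin ![K, K * n + 1] A ≤ ((K * wOrdN n (newtonSet A) + initHeight n (newtonSet A) : ℕ) : ℕ∞) := by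
  obtain ⟨P, hP, hPw, hPh⟩ := exists_eq_initHeight n hN
  refine le_trans (wMin_le_weight_of_mem_newtonSet _ A hP) ?_
  rw [weight_kWeight, hPw, hPh]

/-- EXACT VALUE for `K ≥ ih`: `wMin w_K A = K·m + ih`. -/
theorem wMin_kWeight_eq (K n : ℕ) (A : Fin d → MvPowerSeries (Fin 2) k) (hN : (newtonSet A).Nonempty)
    (hK : initHeight n (newtonSet A) ≤ K) :
    wMin ![K, K * n + 1] A = ((K * wOrdN n (newtonSet A) + initHeight n (newtonSet A) : ℕ) : ℕ∞) := by
  refine le_antisymm (wMin_kWeight_le K n A hN) ?_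
  rw [le_wMin_iff_newtonSet]
  intro P hP
  rw [weight_kWeight, Nat.cast_le]
  have hm := wOrdN_le n hP
  rcases hm.eq_or_lt with heq | hlt
  · have hih := initHeight_le n hP heq.symm
    rw [← heq]
    omega
  · -- off the initial line: `K·(m+1) ≤ K·(P₀ + n P₁)`
    have h1 : K * (wOrdN n (newtonSet A) + 1) ≤ K * (P 0 + n * P 1) := Nat.mul_le_mul_left K hlt
    nlinarith

/-! ## A `w_K`-comparison is the lexicographic comparison of `(m, ih)` -/

/-- FIRST COMPONENT: `wMin w_K A ≤ wMin w_K B` and `K > ih(B)` give `m(A) ≤ m(B)`. -/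
theorem wOrdN_le_of_wMin_kWeight_le {K n : ℕ} {A B : Fin d → MvPowerSeries (Fin 2) k} (hB : (newtonSet B).Nonempty)
    (hK : initHeight n (newtonSet B) < K) (h : wMin ![K, K * n + 1] A ≤ wMin ![K, K * n + 1] B) :
    wOrdN n (newtonSet A) ≤ wOrdN n (newtonSet B) := by
  have h1 := le_trans (le_trans (kmul_wOrdN_le_wMin K n A) h) (wMin_kWeight_le K n B hB)
  rw [Nat.cast_le] at h1
  by_contra hlt
  rw [not_le] at hlt
  have h2 : K * (wOrdN n (newtonSet B) + 1) ≤ K * wOrdN n (newtonSet A) := Nat.mul_le_mul_left K hlt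
  nlinarith

/-- SECOND COMPONENT: with equal `m` and `K ≥ ih(A)`, `wMin w_K A ≤ wMin w_K B` gives `ih(A) ≤ ih(B)`. -/
theorem initHeight_le_of_wMin_kWeight_le {K n : ℕ} {A B : Fin d → MvPowerSeries (Fin 2) k} (hA : (newtonSet A).Nonempty)
    (hB : (newtonSet B).Nonempty) (hK : initHeight n (newtonSet A) ≤ K) (hm : wOrdN n (newtonSet A) = wOrdN n (newtonSet B))
    (h : wMin ![K, K * n + 1] A ≤ wMin ![K, K * n + 1] B) : initHeight n (newtonSet A) ≤ initHeight n (newtonSet B) := by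
  have h1 := le_trans h (wMin_kWeight_le K n B hB)
  rw [wMin_kWeight_eq K n A hA hK, Nat.cast_le, hm] at h1
  omega

/-! ## Hauser–Perlega's conventions are monotone -/

/-- `m_F` is monotone in `m`. -/
theorem mFlagN_mono (L n : ℕ) {N₁ N₂ : Set (Fin 2 →₀ ℕ)} (h : wOrdN n N₁ ≤ wOrdN n N₂) : mFlagN L n N₁ ≤ mFlagN L n N₂ := by
  unfold mFlagN
  split_ifs <;> omega

/-- `d_F` is monotone in the initial height when `m_F` agrees. -/
theorem dFlagN_le_dFlagN (L n : ℕ) {N₁ N₂ : Set (Fin 2 →₀ ℕ)} (hm : mFlagN L n N₁ = mFlagN L n N₂)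
    (hih : initHeight n N₁ ≤ initHeight n N₂) : dFlagN L n N₁ ≤ dFlagN L n N₂ := by
  unfold dFlagN
  rw [hm]
  split_ifs <;> omega

/-- `d_F = 0` when `m < n·L` (then `ih ≤ m/n < L` and `m_F = n·L` is divisible by `L`). -/
theorem dFlagN_eq_zero_of_wOrdN_lt {L n : ℕ} {N : Set (Fin 2 →₀ ℕ)} (hN : N.Nonempty) (h : wOrdN n N < n * L) :
    dFlagN L n N = 0 := by
  have hih : initHeight n N < L := by
    have h1 := mul_initHeight_le_wOrdN n hN
    have h2 : n * initHeight n N < n * L := lt_of_le_of_lt h1 h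
    exact Nat.lt_of_mul_lt_mul_left h2
  have hm : mFlagN L n N = n * L := mFlagN_of_lt h
  unfold dFlagN
  rw [if_neg (not_le.mpr hih), if_neg]
  rw [hm]
  exact fun h' => h'.2 (dvd_mul_left L n)

/-! ## The use: `d_F` of an `m`-maximal flag is at most `d_F` of a `w_K`-maximal tuple -/

/-- **`d_F(C) ≤ d_F(S)`** when `wMin w_K C ≤ wMin w_K S` (e.g. `S` is `w_K`-clean and `C` a re-centring of `S`, Prop. 5.1.3), `m_F(S) ≤ m_F(C)`
(e.g. `C` is the tuple of an `m`-maximal flag and `S` of a competitor) and `K > m(S)` — Perlega's Prop. 7.4.7 (2) «`inv(G) ≤ inv(F)`» for the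
tangent class, the vector weight `ψ` replaced by `w_K`.  [cite: Perlega2020, Prop. 7.4.7 (2) `cleaning_tangential_flags`
(arXiv:2011.14443 §7.4.3, chunk p0093 L160 – p0094 L10)] -/
theorem dFlagN_le_of_wMin_kWeight_le {K L n : ℕ} (hn : 0 < n) {C S : Fin d → MvPowerSeries (Fin 2) k} (hC : (newtonSet C).Nonempty)
    (hS : (newtonSet S).Nonempty) (hK : wOrdN n (newtonSet S) < K) (h : wMin ![K, K * n + 1] C ≤ wMin ![K, K * n + 1] S)
    (hmF : mFlagN L n (newtonSet S) ≤ mFlagN L n (newtonSet C)) : dFlagN L n (newtonSet C) ≤ dFlagN L n (newtonSet S) := by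
  have hihS : initHeight n (newtonSet S) < K := lt_of_le_of_lt (initHeight_le_wOrdN hn hS) hK
  have hm : wOrdN n (newtonSet C) ≤ wOrdN n (newtonSet S) := wOrdN_le_of_wMin_kWeight_le hS hihS h
  rcases hm.eq_or_lt with heq | hlt
  · -- equal `m`: compare the heights
    have hihC : initHeight n (newtonSet C) ≤ K := by
      have := initHeight_le_wOrdN hn hC; omega
    have hih := initHeight_le_of_wMin_kWeight_le hC hS hihC heq h
    have hmF' : mFlagN L n (newtonSet C) = mFlagN L n (newtonSet S) := by unfold mFlagN; rw [heq]
    exact dFlagN_le_dFlagN L n hmF' hih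
  · -- `m(C) < m(S)`: then `m_F(S) ≤ m_F(C)` forces `m(C) < n·L`, so `d_F(C) = 0`
    have hlt' : wOrdN n (newtonSet C) < n * L := by
      by_contra hge
      rw [not_lt] at hge
      have h1 : mFlagN L n (newtonSet C) = wOrdN n (newtonSet C) := mFlagN_of_le hge
      have h2 : mFlagN L n (newtonSet S) = wOrdN n (newtonSet S) := mFlagN_of_le (by omega)
      omega
    rw [dFlagN_eq_zero_of_wOrdN_lt hC hlt']
    exact Nat.zero_le _

end WildMonic

end Summit.ResolutionOfSingularities.ResolutionOfSingularities.Theorems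

end
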